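import Summits.QuantumFields.BalabanUV.T4Continuum.Support.ShellMeasureLiveEndOneCallSlotLevelsCfLinJunction
import Summits.QuantumFields.BalabanUV.T4Continuum.Support.ShellMeasureLiveEndOneCallGibbs
import Summits.QuantumFields.BalabanUV.T4Continuum.Support.ShellMeasureRootCompositionSync

/-!
# `T4Continuum.ShellMeasureLiveEndOneCallUnionLevelsCfLinJunction` — row S111 file 3⁶ «THE ONE CALL v5 — THE JUNCTION WAVE COLLECTED»: BOTH KINDS
# OF LIVE SLOTS — the Gibbs slots `S₀ r K` (leaf-06-g7's f1b, unchanged) ⊔ the background-mediated slots `S₁ r K` (the chain-end host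
# `ShellMeasureLandauEndAssembledDecayCfLinCoTestsSchurCoarseReadOuts` via file 1⁶)
(cell `pub-balaban`, sub-cell `t4`, NE7c (node U5b); crew unit `b2b-balaban-t4-ne7c-formalise-leaf-09` gen 14; owner table row **S111**
(R-ne7cp1-g36-13); imports file 1⁶ `ShellMeasureLiveEndOneCallSlotLevelsCfLinJunction`, f1b `ShellMeasureLiveEndOneCallGibbs` (leaf-06-g7, p231442)
and S27 `ShellMeasureRootCompositionSync` ONLY; [folklore]; 0 `def`, 0 `def … : Prop`, 0 sorry, 0 cite; END-II block generated by files
1⁶∕2⁶'s script in «inr» mode)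

HONEST FRAMING. Finite four-torus programme, rung (B)+1 only — NOT infinite volume, NOT a mass gap, NOT the Clay problem, NOT summit progress; (B),
`BetaPertHyp`, (B^μ) not consumed. NE7c (`T4IndicatorShell.ShellWeightBound`) is NOT PRINTED in [Balaban 1983–89] and NOT PROVED; «NE7c ⇐ the named
binders» (trigger c3): every binder below is DISPLAYED, asserted by nobody; no estimate of Bałaban's is discharged; (M1)₀ ∕ (M1) realized ≠ NE7c.
THIS declaration IS the countdown's object at the live levels (level-0 slots served by the level-0 face); landing it moves NOTHING by itself.
Equation numbers in comments LOCATE displayed shapes, not citations. HONEST DEPENDENCY (cell): continuum YM on T⁴ ⇐ BetaPertH ∧ nine spine estimates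
(0/9 proved); BetaPertH ⇐ (D1) ∧ (D4) ∧ CAP+tail; G-an2-4 gates asym, D1 and NE2/3/4.

THE CHAIN as landed: (1) S108 f2 `ShellMeasureLandauEndAssembledDecayCfLinCoTestsSchur` (leaf-04-g11, p239037) → (2) S108 f3
`ShellMeasureLandauEndAssembledDecayCfLinCoTestsSchurElb` (leaf-07-g10, p239416) → (3) S110
`ShellMeasureLandauEndAssembledDecayCfLinCoTestsSchurCoarse` (leaf-03-g9, p239707) → (4) S109 f2
`ShellMeasureLandauEndAssembledDecayCfLinCoTestsSchurCoarseReadOuts` (leaf-08-g17, p240165) — its LEAVING ∕ ENTERING lists, link by link and in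
words, are in file 1⁶'s module docstring (verbatim from the links' own headers; nothing of Bałaban's discharged at any link).

WHAT IS PROVED ([folklore]). **`shellWeightBound_live_oneCall_union_levels_cfB7_lin_junction`** — v4 f3⁵ (p238484) RE-TYPED over file 1⁶: slot type
`σ₀ ⊕ σ₁`, END-I's slot sets `(S₀ r K).disjSum (S₁ r K)`; on `Sum.inr s` EVERY binder of the chain-end host as an `(r, K, t, s)`-family (file 1⁶'s
list in «inr» form) + `hDslot` guarded on `S₁`; on `Sum.inl s` leaf-06-g7's GIBBS family UNCHANGED (f1b `hac_gibbs_of_identified`); END-I's rows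
VERBATIM; proof = `Finset.mem_disjSum` cases into S27 `shellWeightBound_of_towerData_sync`. CONCLUSION LITERALLY `ShellWeightBound l₀ T A B shA shB
(fun K => Σ over the two disjoint sums)` — token-identical to v4 f3⁵; (t1)–(t4) as file 2⁶; OF RECORD only on the owner's ruling + (x3⁶) + an
outside XREAD. Nothing of Bałaban's discharged.
-/

noncomputable section

open Set Metric NormedSpace MeasureTheory Function Finset
open scoped ENNReal

namespace Summit.QuantumFields.BalabanUV.T4Continuum.ShellMeasureLiveEndOneCallUnionLevelsCfLinJunction

open Literature.MathematicalPhysics.QuantumFieldTheory.Balaban1983to89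
open B11Prop6Scheme (Prop4Hyp)
open GaugeField (GaugeInvariant)
open T4IndicatorShell (ShellWeightBound)
open T4ShellMeasure (SlotAntiConcentration)
open T4ShellMeasureLevels (LiveWindow)
open T4ShellMeasureFibre (slotAntiConcentration_mono)
open T4CubePoincare (cube)
open T4CubeChartGnomonic (SU2)
open T4CubeChartExp (expFibreChart)
open T4TreeGaugeFixing (NoClosedLoop fixTo)
open T4AxialGaugeFixing (combBonds)
open T4AxialGaugeSmallField (boxPlaqs boxBonds)
open T4ShellMeasurePlaquette (expTail₂)
open ShellMeasureLevelAssembly (classifier)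
open ShellMeasureMultiGridNorms (WSup)
open ShellMeasurePinnedNorm (pinW)
open ShellMeasureDecayKernelSums (kerOp)
open ShellMeasureLandauHolonomy (solAt landauExp)
open ShellMeasureLandauHolonomyChart (holOf cplx)
open ShellMeasureLandauHolonomySkew (readOutReal)
open ShellMeasureMultiGridNorms.WSup (toPiL)
open B7Prop2Explicit (C0 c2' unitaryUnits)
open B7Prop1Local (pdevOn loK bondHiK)
open B7Prop5Flat (BondIn)
open ShellMeasureAverageProp4General (O1cov C2cov)
open ShellMeasureLandauCorrectionB7 (landauCf landauRad)
open ShellMeasureLandauCorrectionReal (skewPi)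
open ShellMeasureLandauCfBoxLocal (landauCfBox)
open TreeLengthTorus (TPt)
open B12Decay510Torus (pl1)
open ShellMeasurePinnedNorm (pinDist)
open ShellMeasureCommutatorCovDatum (covIdx covD)
open B7Prop1Explicit (U1)
open ShellMeasureReadOutsMax (Ysp plaqReadOuts)
open ShellMeasureWilsonRealizedSU2 (wilsonU)
open ShellMeasureWilsonGaugeInvariant (giF)
open ShellMeasureRootCompositionSync (shellWeightBound_of_towerData_sync)
open ShellMeasureLiveEndOneCallSlotLevelsCfLinJunction (hac_live_of_assembled_decay_levels_cfB7_lin_junction)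
open ShellMeasureLiveEndOneCallGibbs (hac_gibbs_of_identified)
open scoped Matrix.Norms.L2Operator

variable {σ₀ σ₁ : Type*} {n : Type*} [Fintype n] [DecidableEq n] [Nonempty n]

/-- **`ShellWeightBound` ⇐ THE NAMED BINDERS AT THE LIVE LEVELS, GIBBS SLOTS ⊔ BACKGROUND-MEDIATED SLOTS — AFTER THE JUNCTION WAVE** (row
S111 file 3⁶; module docstring); CONDITIONAL on every displayed binder; nothing PRINTED is asserted; NOT Bałaban's minimiser; NE7c NOT
proved. [folklore] -/
theorem shellWeightBound_live_oneCall_union_levels_cfB7_lin_junction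
    (P : Bool → ℕ → σ₀ ⊕ σ₁ → Params) (jl lvl : Bool → ℕ → σ₀ ⊕ σ₁ → ℕ) [∀ r K s, DecidableEq (PBond (P r K s) (jl r K s))]
    {ε η ρ β D : Bool → ℕ → ℝ} (hη : ∀ r j, 0 < η r j) (hε : ∀ r a, 0 < ε r a) (hρ0 : ∀ r j, 0 ≤ ρ r j) (hD0 : ∀ r j, 0 ≤ D r j)
    (S₀ : Bool → ℕ → Finset σ₀) (S₁ : Bool → ℕ → Finset σ₁) {l₀ : ℝ}
    (F : ∀ r K (t : ℝ) (s : σ₀ ⊕ σ₁), GaugeField (P r K s) (jl r K s) SU2 → ℝ≥0∞)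
    (u : ∀ r K (t : ℝ) (s : σ₀ ⊕ σ₁), GaugeField (P r K s) (jl r K s) SU2 → ℝ)
    -- ══ ON `Sum.inr s` (s : σ₁): EVERY END-II binder of the chain-end host as an (r, K, t, s)-family — file 1's list in «inr» form ══
    {𝒵 ℬ : Bool → ℕ → σ₁ → Type*} [∀ r K s, NormedAddCommGroup (𝒵 r K s)] [∀ r K s, NormedSpace ℂ (𝒵 r K s)] [∀ r K s, NormedAddCommGroup (ℬ r K s)]
    [∀ r K s, NormedSpace ℂ (ℬ r K s)] {𝔸 : Bool → ℕ → σ₁ → Type*} [∀ r K s, CStarAlgebra (𝔸 r K s)] [∀ r K s, Nontrivial (𝔸 r K s)]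
    {lo hi : ∀ r K s, Fin (P r K (Sum.inr s)).d → ℤ} {nb : Bool → ℕ → σ₁ → ℕ} (hn : ∀ r K s, ∀ κ, hi r K s κ ≤ lo r K s κ + nb r K s)
    (hN : ∀ r K s, ∀ κ, hi r K s κ - lo r K s κ < (P r K (Sum.inr s)).sitesPerDir (jl r K (Sum.inr s)))
    (Λ : ∀ r K s, Finset (PBond (P r K (Sum.inr s)) (jl r K (Sum.inr s)))) (hΛbox : ∀ r K s, ∀ b ∈ Λ r K s, b ∈ boxBonds (lo r K s) (hi r K s))
    (hΛcomb : ∀ r K s, Disjoint (Λ r K s) (combBonds (lo r K s) (hi r K s))) {m₀ : Bool → ℕ → σ₁ → ℕ} (e : ∀ r K s, ↥(Λ r K s) × Fin 3 ≃ Fin (m₀ r K s)) {S : ℝ}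
    (hS : 0 < S) (hSπ : 3 * S ^ 2 < Real.pi ^ 2) (hF : ∀ r K t s, Measurable (F r K t (Sum.inr s))) (hFi : ∀ r K t s, GaugeInvariant (F r K t (Sum.inr s)))
    (hu : ∀ r K t s, Measurable (u r K t (Sum.inr s))) (hui : ∀ r K t s, GaugeInvariant (u r K t (Sum.inr s))) {ιc : Bool → ℕ → σ₁ → Type*}
    {Pu : ∀ r K (t : ℝ) s, Finset (ιc r K s)} (hPu : ∀ r K t s, (Pu r K t s).Nonempty)
    (plq : ∀ r K (t : ℝ) s, ιc r K s → B7Prop1Explicit.Site (P r K (Sum.inr s)).d × Fin (P r K (Sum.inr s)).d × Fin (P r K (Sum.inr s)).d)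
    {κN : Bool → ℕ → σ₁ → Type*} (N : ∀ r K (t : ℝ) s, Finset (κN r K s)) {ιN : ∀ r K s, κN r K s → Type*}
    {PuN : ∀ r K (t : ℝ) s, (i : κN r K s) → Finset (ιN r K s i)} (hPuN : ∀ r K t s, ∀ i, (PuN r K t s i).Nonempty) {AN : Bool → ℕ → σ₁ → Type*}
    [∀ r K s, NormedRing (AN r K s)] [∀ r K s, NormedAlgebra ℂ (AN r K s)] [∀ r K s, CompleteSpace (AN r K s)]
    (holN : ∀ r K (t : ℝ) s, (i : κN r K s) → GaugeField (P r K (Sum.inr s)) (jl r K (Sum.inr s)) SU2 → ιN r K s i → (Fin (m₀ r K s) → ℝ) → AN r K s)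
    {θN RN HN δN : ∀ r K (t : ℝ) s, κN r K s → ℝ} (hRN : ∀ r K t s, ∀ i ∈ N r K t s, 1 < RN r K t s i) (hθN : ∀ r K t s, ∀ i ∈ N r K t s, 0 < θN r K t s i)
    (hδ0N : ∀ r K t s, ∀ i ∈ N r K t s, 0 ≤ δN r K t s i) (hδ1N : ∀ r K t s, ∀ i ∈ N r K t s, δN r K t s i ≤ 1)
    (hSMN : ∀ r K t s, ∀ i ∈ N r K t s, 36 * HN r K t s i * 1 ^ 2 / (RN r K t s i - 1) ^ 2 ≤ δN r K t s i * θN r K t s i)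
    (hANN : ∀ r K t s, ∀ i ∈ N r K t s, ∀ V, ∀ x ∈ closedBall (0 : Fin (m₀ r K s) → ℝ) S, ∀ p ∈ PuN r K t s i, ∃ f : ℂ → AN r K s, DifferentiableOn ℂ f (ball 0
      (RN r K t s i)) ∧ (∀ w ∈ ball (0 : ℂ) (RN r K t s i), ‖f w‖ ≤ HN r K t s i) ∧ f 0 = 0 ∧ ∀ c : ℝ, 0 ≤ c → c ≤ 1 → f (c : ℂ) = holN r K t s i V p (c • x) -
      1)
    {δ : ℝ} (Λu : ∀ r K (t : ℝ) s, Finset (B7Prop1Explicit.Site (P r K (Sum.inr s)).d × Fin (P r K (Sum.inr s)).d))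
    (U₀u : ∀ r K (t : ℝ) s, B7Prop1Explicit.Site (P r K (Sum.inr s)).d → Fin (P r K (Sum.inr s)).d → (Matrix n n ℂ)ˣ)
    (hU₀u : ∀ r K t s, ∀ y κ, U₀u r K t s y κ ∈ U1 (Matrix n n ℂ)) (wu : ∀ r K t s, ↥(Λu r K t s) → ℝ) (wu' : ∀ r K t s, ↥(covIdx (Λu r K t s)) → ℝ)
    [∀ r K t s, Fact (∀ b, 0 < wu r K t s b)] [∀ r K t s, Fact (∀ i, 0 < wu' r K t s i)] {w₀ w₀' : ℝ} (hw₀ : 0 < w₀) (hw₀' : 0 < w₀')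
    (hfl : ∀ r K t s, ∀ b, w₀ ≤ wu r K t s b) (hfl' : ∀ r K t s, ∀ i, w₀' ≤ wu' r K t s i)
    (𝒢 : ∀ r K t s, GaugeField (P r K (Sum.inr s)) (jl r K (Sum.inr s)) SU2 → (𝒵 r K s →L[ℂ] (Ysp (Λu r K t s) (η r (jl r K (Sum.inr s))) (U₀u r K t s) (wu r K
      t s) (wu' r K t s))))
    (W𝒱 : ∀ r K t s, GaugeField (P r K (Sum.inr s)) (jl r K (Sum.inr s)) SU2 → (Ysp (Λu r K t s) (η r (jl r K (Sum.inr s))) (U₀u r K t s) (wu r K t s) (wu' r K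
      t s)) → 𝒵 r K s)
    {B₀ C₄ a₃ ε₄ : ℝ} (h𝒢 : ∀ r K t s, ∀ V f, ‖𝒢 r K t s V f‖ ≤ B₀ * ‖f‖) (hW : ∀ r K t s, ∀ V, Prop4Hyp (W𝒱 r K t s V) C₄ a₃) (hB₀ : 0 < B₀) (hC₄ : 0 ≤ C₄)
    (hε₄ : 0 ≤ ε₄) {dL C₁ B₃ ε₁ : ℝ} (hdL : 0 ≤ dL) (hC₁ : 0 ≤ C₁) (hε₁ : 0 ≤ ε₁) (hB₃ : dL ≤ B₃) (h1 : 2 * B₀ * C₁ * B₃ * ε₁ ≤ ε₄) (h2 : 4 * ε₄ ≤ a₃)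
    (h3 : 16 * B₀ * C₄ * ε₄ ≤ 1)
    (H₁ : ∀ r K t s, GaugeField (P r K (Sum.inr s)) (jl r K (Sum.inr s)) SU2 → (ℬ r K s →L[ℂ] (Ysp (Λu r K t s) (η r (jl r K (Sum.inr s))) (U₀u r K t s) (wu r K
      t s) (wu' r K t s))))
    (hH₁ : ∀ r K t s, ∀ V B, ‖H₁ r K t s V B‖ ≤ B₀ * ‖B‖)
    (TΦ : ∀ r K (t : ℝ) s, GaugeField (P r K (Sum.inr s)) (jl r K (Sum.inr s)) SU2 → ((Fin (m₀ r K s) → ℂ) →L[ℂ] (ℬ r K s))) {rΦ : ℝ}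
    (hTb : ∀ r K t s, ∀ V, ‖TΦ r K t s V‖ * rΦ < 2 * dL * C₁ * ε₁) (hSr : S < rΦ) (k : Bool → ℕ → σ₁ → ℕ)
    (Sf Sf' Sw Sw' Se Se' : ∀ r K s, Finset (B7Prop1Explicit.Site (P r K (Sum.inr s)).d × Fin (P r K (Sum.inr s)).d))
    (Ubg : ∀ r K (t : ℝ) s, GaugeField (P r K (Sum.inr s)) (jl r K (Sum.inr s)) SU2 → B7Prop1Explicit.Site (P r K (Sum.inr s)).d → Fin (P r K (Sum.inr s)).d →
      (𝔸 r K s)ˣ)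
    (hUbg : ∀ r K t s, ∀ V x κ, Ubg r K t s V x κ ∈ unitaryUnits (𝔸 r K s)) {α₀ : ℝ} (hα : 0 < α₀) (hα3 : ∀ r K s, C0 (P r K (Sum.inr s)).d * α₀ ≤ 1 / 3)
    (hα4 : ∀ r K s, 4 * α₀ ≤ c2' (P r K (Sum.inr s)).d (P r K (Sum.inr s)).L) (hα6 : ∀ r K s, 4 * O1cov (P r K (Sum.inr s)).d * α₀ ≤ 1 / 3)
    (h52locw : ∀ r K t s, ∀ V (c : ↥(Sw' r K s)), pdevOn (loK (P r K (Sum.inr s)).L (k r K s) c.1.1) (bondHiK (P r K (Sum.inr s)).L (k r K s) c.1.1 c.1.2) (Ubg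
      r K t s V) < α₀ * ((((P r K (Sum.inr s)).L : ℝ) ^ k r K s)⁻¹) ^ 2)
    (h52loce : ∀ r K t s, ∀ V (c : ↥(Se' r K s)), pdevOn (loK (P r K (Sum.inr s)).L (k r K s) c.1.1) (bondHiK (P r K (Sum.inr s)).L (k r K s) c.1.1 c.1.2) (Ubg
      r K t s V) < α₀ * ((((P r K (Sum.inr s)).L : ℝ) ^ k r K s)⁻¹) ^ 2)
    (ϖe₁ : ∀ r K (t : ℝ) s, ↥(Se r K s) → ℝ) (ϖe₂ : ∀ r K (t : ℝ) s, ↥(Se' r K s) → ℝ) (hϖe₁ : ∀ r K t s, ∀ b, 0 ≤ ϖe₁ r K t s b)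
    (hϖe₂ : ∀ r K t s, ∀ c, 0 ≤ ϖe₂ r K t s c) {r₀e : ℝ}
    (hreache : ∀ r K t s, ∀ (c : ↥(Se' r K s)) (b : ↥(Se r K s)), BondIn (loK (P r K (Sum.inr s)).L (k r K s) c.1.1) (bondHiK (P r K (Sum.inr s)).L (k r K s)
      c.1.1 c.1.2) b.1.1 b.1.2 → ϖe₂ r K t s c - r₀e ≤ ϖe₁ r K t s b)
    (ιs : ∀ r K t s, GaugeField (P r K (Sum.inr s)) (jl r K (Sum.inr s)) SU2 → ((Ysp (Λu r K t s) (η r (jl r K (Sum.inr s))) (U₀u r K t s) (wu r K t s) (wu' r K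
      t s)) →L[ℂ] (↥(Sf r K s) → 𝔸 r K s)))
    (hι : ∀ r K t s, ∀ V Y, ‖ιs r K t s V Y‖ ≤ ‖Y‖)
    (Hop : ∀ r K t s, GaugeField (P r K (Sum.inr s)) (jl r K (Sum.inr s)) SU2 → ((↥(Sf' r K s) → 𝔸 r K s) →L[ℂ] (Ysp (Λu r K t s) (η r (jl r K (Sum.inr s)))
      (U₀u r K t s) (wu r K t s) (wu' r K t s))))
    (hH : ∀ r K t s, ∀ V X, ‖Hop r K t s V X‖ ≤ B₀ * ‖X‖) {ε₃ : ℝ} (h18 : ∀ r K s, 18 * C2cov (P r K (Sum.inr s)).d * B₀ * ε₃ ≤ 1)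
    (hcoup : ε₄ + B₀ * (2 * dL * C₁ * ε₁) ≤ ε₃) (h3R : ∀ r K s, 3 * ε₃ ≤ landauRad (P r K (Sum.inr s)).d (P r K (Sum.inr s)).L)
    {Λw Λz Λb : Bool → ℕ → σ₁ → Type*} [∀ r K s, Fintype (Λw r K s)] [∀ r K s, DecidableEq (Λw r K s)] [∀ r K s, Fintype (Λz r K s)]
    [∀ r K s, Fintype (Λb r K s)] {𝔄w ℭ 𝔇 : Bool → ℕ → σ₁ → Type*} [∀ r K s, NormedAddCommGroup (𝔄w r K s)] [∀ r K s, NormedSpace ℂ (𝔄w r K s)]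
    [∀ r K s, CompleteSpace (𝔄w r K s)] [∀ r K s, NormedAddCommGroup (ℭ r K s)] [∀ r K s, NormedSpace ℂ (ℭ r K s)] [∀ r K s, NormedAddCommGroup (𝔇 r K s)]
    [∀ r K s, NormedSpace ℂ (𝔇 r K s)] {δw : ℝ} (hδw : 0 ≤ δw) {Nc : Bool → ℕ → σ₁ → ℕ} [∀ r K s, NeZero (Nc r K s)]
    (Bref : ∀ r K (t : ℝ) s, Finset (TPt (P r K (Sum.inr s)).d (Nc r K s))) (hBref : ∀ r K t s, (Bref r K t s).Nonempty)
    (pos : ∀ r K (t : ℝ) s, Λw r K s → TPt (P r K (Sum.inr s)).d (Nc r K s)) (posz : ∀ r K (t : ℝ) s, Λz r K s → TPt (P r K (Sum.inr s)).d (Nc r K s))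
    (pos' : ∀ r K (t : ℝ) s, ↥(Sw r K s) → TPt (P r K (Sum.inr s)).d (Nc r K s)) (posx : ∀ r K (t : ℝ) s, ↥(Sw' r K s) → TPt (P r K (Sum.inr s)).d (Nc r K s))
    (posb : ∀ r K (t : ℝ) s, Λb r K s → TPt (P r K (Sum.inr s)).d (Nc r K s)) {multw multz multx multb : ℕ}
    (hmultw : ∀ r K t s, ∀ x, (Finset.univ.filter fun b' => pos r K t s b' = x).card ≤ multw)
    (hmultz : ∀ r K t s, ∀ x, (Finset.univ.filter fun b' => posz r K t s b' = x).card ≤ multz)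
    (hmultx : ∀ r K t s, ∀ x, (Finset.univ.filter fun b' => posx r K t s b' = x).card ≤ multx)
    (hmultb : ∀ r K t s, ∀ x, (Finset.univ.filter fun b' => posb r K t s b' = x).card ≤ multb)
    (k𝒢 : ∀ r K (t : ℝ) s, GaugeField (P r K (Sum.inr s)) (jl r K (Sum.inr s)) SU2 → Λw r K s → Λz r K s → (ℭ r K s →L[ℂ] (𝔄w r K s)))
    (kι : ∀ r K (t : ℝ) s, GaugeField (P r K (Sum.inr s)) (jl r K (Sum.inr s)) SU2 → ↥(Sw r K s) → Λw r K s → (𝔄w r K s →L[ℂ] (𝔸 r K s)))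
    (kH : ∀ r K (t : ℝ) s, GaugeField (P r K (Sum.inr s)) (jl r K (Sum.inr s)) SU2 → Λw r K s → ↥(Sw' r K s) → (𝔸 r K s →L[ℂ] (𝔄w r K s)))
    (kH₁ : ∀ r K (t : ℝ) s, GaugeField (P r K (Sum.inr s)) (jl r K (Sum.inr s)) SU2 → Λw r K s → Λb r K s → (𝔇 r K s →L[ℂ] (𝔄w r K s)))
    {c𝒢 δ𝒢 M𝒢 cι δι Mι cH δH MH cH₁ δH₁ MH₁ : ℝ} (hc𝒢 : 0 ≤ c𝒢)
    (hk𝒢 : ∀ r K t s, ∀ V c b', ‖k𝒢 r K t s V c b'‖ ≤ c𝒢 * Real.exp (-(δ𝒢 * pl1 (pos r K t s c - posz r K t s b')))) (hgap𝒢 : δw < δ𝒢)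
    (hM𝒢c : ∀ r K s, (multz : ℝ) * (2 * (((P r K (Sum.inr s)).d : ℝ) + (δ𝒢 - δw)) / (δ𝒢 - δw)) ^ (P r K (Sum.inr s)).d ≤ M𝒢) (hcι : 0 ≤ cι)
    (hkι : ∀ r K t s, ∀ V c b', ‖kι r K t s V c b'‖ ≤ cι * Real.exp (-(δι * pl1 (pos' r K t s c - pos r K t s b')))) (hgapι : δw < δι)
    (hMιc : ∀ r K s, (multw : ℝ) * (2 * (((P r K (Sum.inr s)).d : ℝ) + (δι - δw)) / (δι - δw)) ^ (P r K (Sum.inr s)).d ≤ Mι) (hcH : 0 ≤ cH)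
    (hkH : ∀ r K t s, ∀ V c b', ‖kH r K t s V c b'‖ ≤ cH * Real.exp (-(δH * pl1 (pos r K t s c - posx r K t s b')))) (hgapH : δw < δH)
    (hMHc : ∀ r K s, (multx : ℝ) * (2 * (((P r K (Sum.inr s)).d : ℝ) + (δH - δw)) / (δH - δw)) ^ (P r K (Sum.inr s)).d ≤ MH) (hcH₁ : 0 ≤ cH₁)
    (hkH₁ : ∀ r K t s, ∀ V c b', ‖kH₁ r K t s V c b'‖ ≤ cH₁ * Real.exp (-(δH₁ * pl1 (pos r K t s c - posb r K t s b')))) (hgapH₁ : δw < δH₁)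
    (hMH₁c : ∀ r K s, (multb : ℝ) * (2 * (((P r K (Sum.inr s)).d : ℝ) + (δH₁ - δw)) / (δH₁ - δw)) ^ (P r K (Sum.inr s)).d ≤ MH₁)
    (W𝒱w : ∀ r K (t : ℝ) s, GaugeField (P r K (Sum.inr s)) (jl r K (Sum.inr s)) SU2 → (Λw r K s → 𝔄w r K s) → (Λz r K s → ℭ r K s)) {B₀w C₄w a₃w ε₄w bw : ℝ}
    (hB𝒢w : c𝒢 * M𝒢 ≤ B₀w) (hWw : ∀ r K t s, ∀ V, Prop4Hyp (W𝒱w r K t s V) C₄w a₃w) (hB₀w : 0 < B₀w) (hC₄w : 0 ≤ C₄w) (hε₄w : 0 ≤ ε₄w)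
    (hdomw : 2 * (ε₄w + B₀w * bw) ≤ a₃w) (hselfw : B₀w * C₄w * (ε₄w + B₀w * bw) ^ 2 ≤ ε₄w) (hcontrw : 4 * B₀w * C₄w * (ε₄w + B₀w * bw) < 1)
    (hBH₁w : cH₁ * MH₁ ≤ B₀w)
    (Tw : ∀ r K (t : ℝ) s, GaugeField (P r K (Sum.inr s)) (jl r K (Sum.inr s)) SU2 → ((Fin (m₀ r K s) → ℂ) →L[ℂ] (Λb r K s → 𝔇 r K s))) {rΦw : ℝ}
    (hTbw : ∀ r K t s, ∀ V, ‖Tw r K t s V‖ * rΦw < bw) (h2Sw : 2 * S ≤ rΦw) (hιw : ∀ r K t s, ∀ V Y, ‖kerOp (kι r K t s V) Y‖ ≤ ‖Y‖) (hBHw : cH * MH ≤ B₀w)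
    (hqw : ∀ r K s, 9 * C2cov (P r K (Sum.inr s)).d * B₀w * (ε₄w + B₀w * bw) < 1)
    (hRCw : ∀ r K s, 6 * (ε₄w + B₀w * bw) ≤ landauRad (P r K (Sum.inr s)).d (P r K (Sum.inr s)).L) (NW : ∀ r K (t : ℝ) s, Λz r K s → Λw r K s → Prop)
    (hlocW : ∀ r K t s, ∀ V, ∀ A A' : Λw r K s → 𝔄w r K s, ∀ c', (∀ b', NW r K t s c' b' → A b' = A' b') → W𝒱w r K t s V A c' = W𝒱w r K t s V A' c') {rW : ℝ}
    (hreachW : ∀ r K t s, ∀ c' b', NW r K t s c' b' → pinDist (Bref r K t s) (hBref r K t s) (posz r K t s c') - rW ≤ pinDist (Bref r K t s) (hBref r K t s)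
      (pos r K t s b'))
    {rC : ℝ}
    (hreachC : ∀ r K t s, ∀ (c' : ↥(Sw' r K s)) (b' : ↥(Sw r K s)), BondIn (loK (P r K (Sum.inr s)).L (k r K s) c'.1.1) (bondHiK (P r K (Sum.inr s)).L (k r K s)
      c'.1.1 c'.1.2) b'.1.1 b'.1.2 → pinDist (Bref r K t s) (hBref r K t s) (posx r K t s c') - rC ≤ pinDist (Bref r K t s) (hBref r K t s) (pos' r K t s b'))
    (hsupp : ∀ r K t s, ∀ V, ∀ z : Fin (m₀ r K s) → ℂ, ∀ i, 0 < pinDist (Bref r K t s) (hBref r K t s) (posb r K t s i) → Tw r K t s V z i = 0)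
    (hqW : c𝒢 * M𝒢 * (2 * C₄w * a₃w * Real.exp (δw * rW)) < 1)
    (hk : ∀ r K s, 2 * C2cov (P r K (Sum.inr s)).d * landauRad (P r K (Sum.inr s)).d (P r K (Sum.inr s)).L * Real.exp (δw * rC) * (cι * Mι) * (cH * MH) < 1)
    {𝔭 : Bool → ℕ → σ₁ → Type*} (Pw : ∀ r K (t : ℝ) s, Finset (𝔭 r K s)) (ℓw : ∀ r K (t : ℝ) s, 𝔭 r K s → List ((Λw r K s → 𝔄w r K s) →L[ℂ] Matrix n n ℂ))
    (suppw : ∀ r K (t : ℝ) s, 𝔭 r K s → Finset (Λw r K s)) (ϖPw : ∀ r K (t : ℝ) s, 𝔭 r K s → ℝ)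
    (hblindw : ∀ r K t s, ∀ p ∈ Pw r K t s, ∀ ℓ ∈ ℓw r K t s p, ∀ A A' : Λw r K s → 𝔄w r K s, (∀ b' ∈ suppw r K t s p, A b' = A' b') → ℓ A = ℓ A')
    (hdepthw : ∀ r K t s, ∀ p ∈ Pw r K t s, ∀ b' ∈ suppw r K t s p, ϖPw r K t s p ≤ pinDist (Bref r K t s) (hBref r K t s) (pos r K t s b'))
    (hϖPw : ∀ r K t s, ∀ p ∈ Pw r K t s, 0 ≤ ϖPw r K t s p) {κwb κcb : Bool → ℕ → ℝ} (hκwb : ∀ r K s, 0 ≤ κwb r (jl r K (Sum.inr s)))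
    (hκcb : ∀ r K s, 0 ≤ κcb r (jl r K (Sum.inr s))) (hℓwb : ∀ r K t s, ∀ p ∈ Pw r K t s, ∀ ℓ ∈ ℓw r K t s p, ‖ℓ‖ ≤ κwb r (jl r K (Sum.inr s)))
    (hcurlw : ∀ r K t s, ∀ p ∈ Pw r K t s, ‖(ℓw r K t s p).sum‖ ≤ κcb r (jl r K (Sum.inr s))) {mw : ℕ}
    (hlenw : ∀ r K t s, ∀ p ∈ Pw r K t s, (ℓw r K t s p).length ≤ mw) (𝓡𝒴w : ∀ r K (t : ℝ) s, AddSubgroup (Λw r K s → 𝔄w r K s))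
    (h𝓡𝒴w : ∀ r K t s, IsClosed (𝓡𝒴w r K t s : Set (Λw r K s → 𝔄w r K s))) (𝓡𝒵w : ∀ r K (t : ℝ) s, AddSubgroup (Λz r K s → ℭ r K s))
    (𝓡ℬw : ∀ r K (t : ℝ) s, AddSubgroup (Λb r K s → 𝔇 r K s)) (h𝒢rw : ∀ r K t s, ∀ V, ∀ f ∈ 𝓡𝒵w r K t s, kerOp (k𝒢 r K t s V) f ∈ 𝓡𝒴w r K t s)
    (hWrw : ∀ r K t s, ∀ V, ∀ Y ∈ 𝓡𝒴w r K t s, W𝒱w r K t s V Y ∈ 𝓡𝒵w r K t s)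
    (hιrw : ∀ r K t s, ∀ V, ∀ Y ∈ 𝓡𝒴w r K t s, kerOp (kι r K t s V) Y ∈ skewPi ↥(Sw r K s))
    (hHrw : ∀ r K t s, ∀ V, ∀ X ∈ skewPi (𝔸 := 𝔸 r K s) ↥(Sw' r K s), kerOp (kH r K t s V) X ∈ 𝓡𝒴w r K t s)
    (hH₁rw : ∀ r K t s, ∀ V, ∀ B ∈ 𝓡ℬw r K t s, kerOp (kH₁ r K t s V) B ∈ 𝓡𝒴w r K t s)
    (hTrw : ∀ r K t s, ∀ V (y : Fin (m₀ r K s) → ℝ), Tw r K t s V (cplx y) ∈ 𝓡ℬw r K t s)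
    (hskew : ∀ r K t s, ∀ p ∈ Pw r K t s, ∀ ℓ ∈ ℓw r K t s p, ∀ Y ∈ 𝓡𝒴w r K t s, ℓ Y ∈ skewAdjoint (Matrix n n ℂ))
    (Bp : ∀ r K (t : ℝ) s, GaugeField (P r K (Sum.inr s)) (jl r K (Sum.inr s)) SU2 → 𝔭 r K s → Matrix n n ℂ) {d : ∀ r K (t : ℝ) s, 𝔭 r K s → ℝ}
    {dbar : Bool → ℕ → ℝ} (hBu : ∀ r K t s, ∀ V, ∀ p ∈ Pw r K t s, Bp r K t s V p ∈ unitary (Matrix n n ℂ))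
    (hBd : ∀ r K t s, ∀ V, ∀ p ∈ Pw r K t s, ‖Bp r K t s V p - 1‖ ≤ d r K t s p) (hd : ∀ r K t s, ∀ p ∈ Pw r K t s, d r K t s p ≤ dbar r (jl r K (Sum.inr s)))
    (hdbar : ∀ r K s, 0 ≤ dbar r (jl r K (Sum.inr s))) {Kw : Bool → ℕ → ℝ}
    (hKw : ∀ r K t s, ∑ p ∈ Pw r K t s, Real.exp (-(δw * ϖPw r K t s p)) ≤ Kw r (jl r K (Sum.inr s))) {Λe : Bool → ℕ → σ₁ → Type*} [∀ r K s, Fintype (Λe r K s)]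
    {𝔄 : Bool → ℕ → σ₁ → Type*} [∀ r K s, NormedAddCommGroup (𝔄 r K s)] [∀ r K s, NormedSpace ℂ (𝔄 r K s)] [∀ r K s, CompleteSpace (𝔄 r K s)] {δ' : ℝ}
    {ϖ : ∀ r K (t : ℝ) s, Λe r K s → ℝ} (hδ' : 0 ≤ δ') (hϖ : ∀ r K t s, ∀ b', 0 ≤ ϖ r K t s b') {𝒵e ℬe : Bool → ℕ → σ₁ → Type*}
    [∀ r K s, NormedAddCommGroup (𝒵e r K s)] [∀ r K s, NormedSpace ℂ (𝒵e r K s)] [∀ r K s, NormedAddCommGroup (ℬe r K s)] [∀ r K s, NormedSpace ℂ (ℬe r K s)]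
    (𝒢e : ∀ r K t s, GaugeField (P r K (Sum.inr s)) (jl r K (Sum.inr s)) SU2 → (𝒵e r K s →L[ℂ] WSup (pinW δ' (ϖ r K t s)) 1 (𝔄 r K s)))
    (W𝒱e : ∀ r K t s, GaugeField (P r K (Sum.inr s)) (jl r K (Sum.inr s)) SU2 → WSup (pinW δ' (ϖ r K t s)) 1 (𝔄 r K s) → 𝒵e r K s) {B₀e C₄e a₃e be ε₄e : ℝ}
    (h𝒢e : ∀ r K t s, ∀ V f, ‖𝒢e r K t s V f‖ ≤ B₀e * ‖f‖) (hWe : ∀ r K t s, ∀ V, Prop4Hyp (W𝒱e r K t s V) C₄e a₃e) (hB₀e : 0 < B₀e) (hC₄e : 0 ≤ C₄e)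
    (hbe : 0 ≤ be) (hε₄e : 0 ≤ ε₄e) (hdome : 2 * (ε₄e + B₀e * be) ≤ a₃e) (hselfe : B₀e * C₄e * (ε₄e + B₀e * be) ^ 2 ≤ ε₄e)
    (hcontre : 4 * B₀e * C₄e * (ε₄e + B₀e * be) < 1)
    (H₁e : ∀ r K t s, GaugeField (P r K (Sum.inr s)) (jl r K (Sum.inr s)) SU2 → (ℬe r K s →L[ℂ] WSup (pinW δ' (ϖ r K t s)) 1 (𝔄 r K s)))
    (hH₁e : ∀ r K t s, ∀ V B, ‖H₁e r K t s V B‖ ≤ B₀e * ‖B‖)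
    (Te : ∀ r K (t : ℝ) s, GaugeField (P r K (Sum.inr s)) (jl r K (Sum.inr s)) SU2 → ((Fin (m₀ r K s) → ℂ) →L[ℂ] (ℬe r K s))) {rΦe : ℝ}
    (hTbe : ∀ r K t s, ∀ V, ‖Te r K t s V‖ * rΦe < be) (hSre : S < rΦe)
    (ιe : ∀ r K t s, GaugeField (P r K (Sum.inr s)) (jl r K (Sum.inr s)) SU2 → (WSup (pinW δ' (ϖ r K t s)) 1 (𝔄 r K s) →L[ℂ] WSup (pinW δ' (ϖe₁ r K t s)) 1 (𝔸 r
      K s)))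
    (hιe : ∀ r K t s, ∀ V Y, ‖ιe r K t s V Y‖ ≤ ‖Y‖)
    (He : ∀ r K t s, GaugeField (P r K (Sum.inr s)) (jl r K (Sum.inr s)) SU2 → (WSup (pinW δ' (ϖe₂ r K t s)) 1 (𝔸 r K s) →L[ℂ] WSup (pinW δ' (ϖ r K t s)) 1 (𝔄 r
      K s)))
    (hHe : ∀ r K t s, ∀ V X, ‖He r K t s V X‖ ≤ B₀e * ‖X‖)
    (hqe : ∀ r K s, 9 * (C2cov (P r K (Sum.inr s)).d * Real.exp (2 * δ' * r₀e)) * B₀e * (ε₄e + B₀e * be) < 1)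
    (hRCe : ∀ r K s, 3 * (ε₄e + B₀e * be) ≤ landauRad (P r K (Sum.inr s)).d (P r K (Sum.inr s)).L) {𝔱 : Bool → ℕ → σ₁ → Type*}
    (I : ∀ r K (t : ℝ) s, Finset (𝔱 r K s)) {Ef : ∀ r K (t : ℝ) s, 𝔱 r K s → (Λe r K s → 𝔄 r K s) → ℂ} {rE : ℝ} {ee : ∀ r K (t : ℝ) s, 𝔱 r K s → ℝ}
    (hrE : 0 < rE) (hEd : ∀ r K t s, ∀ i ∈ I r K t s, DifferentiableOn ℂ (Ef r K t s i) (ball 0 rE))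
    (hEb : ∀ r K t s, ∀ i ∈ I r K t s, ∀ Z ∈ ball (0 : Λe r K s → 𝔄 r K s) rE, ‖Ef r K t s i Z‖ ≤ ee r K t s i)
    (supp : ∀ r K (t : ℝ) s, 𝔱 r K s → Finset (Λe r K s))
    (hblind : ∀ r K t s, ∀ i ∈ I r K t s, ∀ A₁ A₂ : Λe r K s → 𝔄 r K s, (∀ b' ∈ supp r K t s i, A₁ b' = A₂ b') → Ef r K t s i A₁ = Ef r K t s i A₂)
    (ϖP : ∀ r K (t : ℝ) s, 𝔱 r K s → ℝ) (hdepth : ∀ r K t s, ∀ i ∈ I r K t s, ∀ b' ∈ supp r K t s i, ϖP r K t s i ≤ ϖ r K t s b') {LK : ℝ}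
    (hK : ∀ r K t s, ∑ i ∈ I r K t s, 2 * ee r K t s i / rE * Real.exp (-(δ' * ϖP r K t s i)) ≤ LK)
    (hcoupE : ∀ r K s, ((ε₄e + B₀e * be) + B₀e * (4 * (C2cov (P r K (Sum.inr s)).d * Real.exp (2 * δ' * r₀e)) * (ε₄e + B₀e * be) ^ 2)) ≤ rE / 2)
    {Ω : Bool → ℕ → σ₁ → Type*} [∀ r K s, MeasurableSpace (Ω r K s)] (μ : ∀ r K (t : ℝ) s, Measure (Ω r K s)) {g : ∀ r K (t : ℝ) s, Ω r K s → ℝ}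
    (hg : ∀ r K t s, ∀ ω, 0 ≤ g r K t s ω) (Aex : ∀ r K (t : ℝ) s, GaugeField (P r K (Sum.inr s)) (jl r K (Sum.inr s)) SU2 → (Fin (m₀ r K s) → ℝ) → Ω r K s → ℝ)
    {Bd : ℝ}
    (hint : ∀ r K t s, ∀ V, ∀ x ∈ closedBall (0 : Fin (m₀ r K s) → ℝ) S, ∀ c : ℝ, 1 / 2 ≤ c → c ≤ 1 → Integrable (fun ω => g r K t s ω * Real.exp (Aex r K t s V
      (c • x) ω)) (μ r K t s))
    (hpos : ∀ r K t s, ∀ V, ∀ x ∈ closedBall (0 : Fin (m₀ r K s) → ℝ) S, ∀ c : ℝ, 1 / 2 ≤ c → c ≤ 1 → 0 < ∫ ω, g r K t s ω * Real.exp (Aex r K t s V (c • x) ω)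
      ∂(μ r K t s))
    (hA : ∀ r K t s, ∀ V, ∀ x ∈ closedBall (0 : Fin (m₀ r K s) → ℝ) S, ∀ c : ℝ, 1 / 2 ≤ c → c ≤ 1 → ∀ ω, Aex r K t s V x ω ≤ Aex r K t s V (c • x) ω + (1 - c) *
      Bd)
    {BE₂ : ℝ} (hElb₂ : ∀ r K t s, ∀ V (y : Fin (m₀ r K s) → ℝ), ‖y‖ ≤ S → -BE₂ ≤ (-Real.log (∫ ω, g r K t s ω * Real.exp (Aex r K t s V y ω) ∂(μ r K t s))))
    (L : ∀ r K t s, Set ((Ysp (Λu r K t s) (η r (jl r K (Sum.inr s))) (U₀u r K t s) (wu r K t s) (wu' r K t s)) →L[ℂ] Matrix n n ℂ))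
    (𝓡𝒵 : ∀ r K (t : ℝ) s, AddSubgroup (𝒵 r K s)) (𝓡ℬ : ∀ r K (t : ℝ) s, AddSubgroup (ℬ r K s))
    (h𝒢r : ∀ r K t s, ∀ V, ∀ f ∈ 𝓡𝒵 r K t s, 𝒢 r K t s V f ∈ readOutReal (L r K t s))
    (hWr : ∀ r K t s, ∀ V, ∀ Y ∈ readOutReal (L r K t s), W𝒱 r K t s V Y ∈ 𝓡𝒵 r K t s)
    (hιr : ∀ r K t s, ∀ V, ∀ Y ∈ readOutReal (L r K t s), ιs r K t s V Y ∈ skewPi ↥(Sf r K s))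
    (hHr : ∀ r K t s, ∀ V, ∀ X ∈ skewPi (𝔸 := 𝔸 r K s) ↥(Sf' r K s), Hop r K t s V X ∈ readOutReal (L r K t s))
    (hH₁r : ∀ r K t s, ∀ V, ∀ B ∈ 𝓡ℬ r K t s, H₁ r K t s V B ∈ readOutReal (L r K t s))
    (hTr : ∀ r K t s, ∀ V (y : Fin (m₀ r K s) → ℝ), TΦ r K t s V (cplx y) ∈ 𝓡ℬ r K t s)
    (hRdict : ∀ r K t s, ∀ V, ∀ x ∈ cube (m₀ r K s) S, F r K t (Sum.inr s) (fixTo (combBonds (lo r K s) (hi r K s)) 1 (updateFinset V (Λ r K s) (expFibreChart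
      (Λ r K s) 1 (e r K s) x))) = (closedBall (0 : Fin (m₀ r K s) → ℝ) S ∩ ⋂ i ∈ N r K t s, {y | classifier (hPuN r K t s i) (holN r K t s i V) y < θN r K t s
      i}).indicator (1 : (Fin (m₀ r K s) → ℝ) → ℝ≥0∞) x * ENNReal.ofReal (Real.exp (-((∑ p ∈ Pw r K t s, β r (jl r K (Sum.inr s)) * (1 - (Matrix.trace (Bp r K t
      s V p * holOf (ℓw r K t s p) (fun y => landauExp (landauCfBox (P r K (Sum.inr s)).L (Ubg r K t s V) (k r K s) (Sw r K s) (Sw' r K s) (landauRad (P r K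
      (Sum.inr s)).d (P r K (Sum.inr s)).L)) (kerOp (kι r K t s V)) (kerOp (kH r K t s V)) (4 * C2cov (P r K (Sum.inr s)).d * (ε₄w + B₀w * bw) ^ 2) (solAt
      (kerOp (k𝒢 r K t s V)) 0 (W𝒱w r K t s V) ε₄w (0 : Λz r K s → ℭ r K s) (kerOp (kH₁ r K t s V) (Tw r K t s V (cplx y))) + kerOp (kH₁ r K t s V) (Tw r K t s
      V (cplx y)))) x)).re / Fintype.card n)) + ((∑ i ∈ I r K t s, Ef r K t s i (WSup.toPiL (𝔄 := 𝔄 r K s) (pinW δ' (ϖ r K t s)) 1 (landauExp (fun Y : WSup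
      (pinW δ' (ϖe₁ r K t s)) 1 (𝔸 r K s) => ((toPiL (pinW δ' (ϖe₂ r K t s)) 1).symm (landauCf (P r K (Sum.inr s)).L (Ubg r K t s V) (k r K s) (Se r K s) (Se' r
      K s) (toPiL (pinW δ' (ϖe₁ r K t s)) 1 Y)) : WSup (pinW δ' (ϖe₂ r K t s)) 1 (𝔸 r K s))) (ιe r K t s V) (He r K t s V) (4 * (C2cov (P r K (Sum.inr s)).d *
      Real.exp (2 * δ' * r₀e)) * (ε₄e + B₀e * be) ^ 2) (solAt (𝒢e r K t s V) 0 (W𝒱e r K t s V) ε₄e (0 : 𝒵e r K s) (H₁e r K t s V (Te r K t s V (cplx x))) + H₁e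
      r K t s V (Te r K t s V (cplx x)))))).re + (-Real.log (∫ ω, g r K t s ω * Real.exp (Aex r K t s V x ω) ∂(μ r K t s))))))))
    (hudict : ∀ r K t s, ∀ V, ∀ x ∈ cube (m₀ r K s) S, u r K t (Sum.inr s) (fixTo (combBonds (lo r K s) (hi r K s)) 1 (updateFinset V (Λ r K s) (expFibreChart
      (Λ r K s) 1 (e r K s) x))) = classifier (hPu r K t s) (fun p => holOf (plaqReadOuts (Λu r K t s) (η r (jl r K (Sum.inr s))) (U₀u r K t s) (wu r K t s)
      (wu' r K t s) (plq r K t s p).1 (plq r K t s p).2.1 (plq r K t s p).2.2) (fun y => landauExp ((ball (0 : ↥(Sf r K s) → 𝔸 r K s) (landauRad (P r K (Sum.inr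
      s)).d (P r K (Sum.inr s)).L)).indicator (landauCf (P r K (Sum.inr s)).L (1 : B7Prop1Explicit.Site (P r K (Sum.inr s)).d → Fin (P r K (Sum.inr s)).d → (𝔸 r
      K s)ˣ) (k r K s) (Sf r K s) (Sf' r K s))) (ιs r K t s V) (Hop r K t s V) (4 * C2cov (P r K (Sum.inr s)).d * (ε₄ + B₀ * (2 * dL * C₁ * ε₁)) ^ 2) (solAt (𝒢
      r K t s V) 0 (W𝒱 r K t s V) ε₄ (0 : 𝒵 r K s) (H₁ r K t s V (TΦ r K t s V (cplx y))) + H₁ r K t s V (TΦ r K t s V (cplx y))))) x)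
    (hδ0 : 0 ≤ δ) (hδ1 : δ < 1) {c₁ c₂ zs : ℝ} (hη1 : ∀ r K s, η r (jl r K (Sum.inr s)) ≤ 1)
    (hs₁' : ∀ r K s, 2 * ((ε₄ + B₀ * (2 * dL * C₁ * ε₁)) + B₀ * (4 * C2cov (P r K (Sum.inr s)).d * (ε₄ + B₀ * (2 * dL * C₁ * ε₁)) ^ 2)) ≤ c₁ * w₀' ^ 2 * zs)
    (ha' : ∀ r K s, ((ε₄ + B₀ * (2 * dL * C₁ * ε₁)) + B₀ * (4 * C2cov (P r K (Sum.inr s)).d * (ε₄ + B₀ * (2 * dL * C₁ * ε₁)) ^ 2)) ≤ c₂ * w₀ * zs)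
    (hma' : ∀ r K s, 4 * ((ε₄ + B₀ * (2 * dL * C₁ * ε₁)) + B₀ * (4 * C2cov (P r K (Sum.inr s)).d * (ε₄ + B₀ * (2 * dL * C₁ * ε₁)) ^ 2)) ≤ w₀)
    (hsm : ∀ r K s, 36 * (c₁ * zs + (4 : ℕ) ^ 2 * c₂ ^ 2 * zs ^ 2) / (rΦ / S - 1) ^ 2 ≤ δ * ε r (K - lvl r K (Sum.inr s))) {a : ℝ} (ha0 : 0 ≤ a)
    (hrad : ∀ r K s, (((P r K (Sum.inr s)).d - 1 : ℕ) : ℝ) * nb r K s * a ≤ 2 * Real.sin (S / 2))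
    {Pcore Pcollar : ∀ r K (t : ℝ) s, Set (Plaq (P r K (Sum.inr s)) (jl r K (Sum.inr s)))}
    (hcover : ∀ r K t s, boxPlaqs (lo r K s) (hi r K s) ⊆ Pcore r K t s ∪ (Pcollar r K t s))
    (hcore : ∀ r K t s, ∀ (V : GaugeField (P r K (Sum.inr s)) (jl r K (Sum.inr s)) SU2) (y : ↥(Λ r K s) → SU2), u r K t (Sum.inr s) (fixTo (combBonds (lo r K s)
      (hi r K s)) 1 (updateFinset V (Λ r K s) y)) < ε r (K - lvl r K (Sum.inr s)) * η r (jl r K (Sum.inr s)) ^ 2 → PlaqSmallOn (Pcore r K t s) a (fixTo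
      (combBonds (lo r K s) (hi r K s)) 1 (updateFinset V (Λ r K s) y)))
    (hcollar : ∀ r K t s, ∀ (V : GaugeField (P r K (Sum.inr s)) (jl r K (Sum.inr s)) SU2) (y : ↥(Λ r K s) → SU2), F r K t (Sum.inr s) (fixTo (combBonds (lo r K
      s) (hi r K s)) 1 (updateFinset V (Λ r K s) y)) ≠ 0 → PlaqSmallOn (Pcollar r K t s) a (fixTo (combBonds (lo r K s) (hi r K s)) 1 (updateFinset V (Λ r K s)
      y)))
    (hρ : ∀ r j, ρ r j ≤ (1 - δ) / 2) (hβ : ∀ r j, 0 ≤ β r j)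
    -- the slot → level majorant on the END-II slots: the host's (= S99 f3b's) constant (written out ONCE), guarded on `S₁ r K`
    (hDslot : ∀ r K t, |t| ≤ l₀ → ∀ s ∈ S₁ r K, 2 * ((m₀ r K s : ℝ) + (3 * (|β r (jl r K (Sum.inr s))| * ((dbar r (jl r K (Sum.inr s)) + 2 * (κcb r (jl r K
      (Sum.inr s)) * (cH₁ * MH₁ * bw / ((1 - c𝒢 * M𝒢 * (2 * C₄w * a₃w * Real.exp (δw * rW))) * (1 - 2 * C2cov (P r K (Sum.inr s)).d * landauRad (P r K (Sum.inr
      s)).d (P r K (Sum.inr s)).L * Real.exp (δw * rC) * (cι * Mι) * (cH * MH)))) + expTail₂ (mw * (κwb r (jl r K (Sum.inr s)) * (cH₁ * MH₁ * bw / ((1 - c𝒢 * M𝒢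
      * (2 * C₄w * a₃w * Real.exp (δw * rW))) * (1 - 2 * C2cov (P r K (Sum.inr s)).d * landauRad (P r K (Sum.inr s)).d (P r K (Sum.inr s)).L * Real.exp (δw *
      rC) * (cι * Mι) * (cH * MH))))))) / (rΦw / S)) * (2 * (κcb r (jl r K (Sum.inr s)) * (cH₁ * MH₁ * bw / ((1 - c𝒢 * M𝒢 * (2 * C₄w * a₃w * Real.exp (δw *
      rW))) * (1 - 2 * C2cov (P r K (Sum.inr s)).d * landauRad (P r K (Sum.inr s)).d (P r K (Sum.inr s)).L * Real.exp (δw * rC) * (cι * Mι) * (cH * MH)))) +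
      expTail₂ (mw * (κwb r (jl r K (Sum.inr s)) * (cH₁ * MH₁ * bw / ((1 - c𝒢 * M𝒢 * (2 * C₄w * a₃w * Real.exp (δw * rW))) * (1 - 2 * C2cov (P r K (Sum.inr
      s)).d * landauRad (P r K (Sum.inr s)).d (P r K (Sum.inr s)).L * Real.exp (δw * rC) * (cι * Mι) * (cH * MH))))))) / (rΦw / S))) * Kw r (jl r K (Sum.inr
      s))) + (3 * (LK * (2 * ((ε₄e + B₀e * be) + B₀e * (4 * (C2cov (P r K (Sum.inr s)).d * Real.exp (2 * δ' * r₀e)) * (ε₄e + B₀e * be) ^ 2)))) / (rΦe / S - 1) +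
      Bd))) / (1 - δ) ≤ D r (lvl r K (Sum.inr s)))
    -- ══ ON `Sum.inl s` (s : σ₀): THE GIBBS SLOTS — f1b `hac_gibbs_of_identified`'s binders (box data, (SM)₀, `hD₀`, `hF₀`∕`hu₀`) ══
    (lo₀ hi₀ : ∀ r K (s : σ₀), Fin (P r K (Sum.inl s)).d → ℤ) {mb : Bool → ℕ → σ₀ → ℕ}
    (hN₀ : ∀ r K s κ, hi₀ r K s κ - lo₀ r K s κ < (P r K (Sum.inl s)).sitesPerDir (jl r K (Sum.inl s)))
    (hm : ∀ r K s κ, hi₀ r K s κ ≤ lo₀ r K s κ + mb r K s)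
    (Λg : ∀ r K (s : σ₀), Finset (PBond (P r K (Sum.inl s)) (jl r K (Sum.inl s))))
    (hΛbox₀ : ∀ r K s, ∀ b ∈ Λg r K s, b ∈ boxBonds (lo₀ r K s) (hi₀ r K s))
    (hΛcomb₀ : ∀ r K s, Disjoint (Λg r K s) (combBonds (lo₀ r K s) (hi₀ r K s)))
    (hcov : ∀ r K s, ∀ b ∈ boxBonds (lo₀ r K s) (hi₀ r K s), b ∉ Λg r K s →
      b ∈ (combBonds (lo₀ r K s) (hi₀ r K s) : Finset (PBond (P r K (Sum.inl s)) (jl r K (Sum.inl s)))))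
    {m₀g : Bool → ℕ → σ₀ → ℕ} (eg : ∀ r K s, ↥(Λg r K s) × Fin 3 ≃ Fin (m₀g r K s))
    {S0 : ℝ} (hS0 : 0 < S0) (hS08 : S0 ≤ 1 / 8) (hS0π : 3 * S0 ^ 2 < Real.pi ^ 2)
    {σc : Bool → ℕ → σ₀ → ℝ} (hσ : ∀ r K s, 0 < σc r K s)
    (hrad₀ : ∀ r K s, (((P r K (Sum.inl s)).d - 1 : ℕ) : ℝ) * mb r K s * σc r K s ≤ 2 * S0 / Real.pi)
    {Pug : ∀ r K (s : σ₀), Finset (Plaq (P r K (Sum.inl s)) (jl r K (Sum.inl s)))} (hPug : ∀ r K s, (Pug r K s).Nonempty)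
    (hPubox : ∀ r K s, ∀ p ∈ Pug r K s, p ∈ boxPlaqs (lo₀ r K s) (hi₀ r K s))
    (Pwg : ∀ r K (s : σ₀), Finset (Plaq (P r K (Sum.inl s)) (jl r K (Sum.inl s))))
    (hSM : ∀ r K s, 4 * (8 * S0) ^ 2 * Real.exp (2 * (8 * S0)) ≤ δ * (ε r (K - lvl r K (Sum.inl s)) * η r (jl r K (Sum.inl s)) ^ 2))
    (hSMσ : ∀ r K s, 4 * (8 * S0) ^ 2 * Real.exp (2 * (8 * S0)) ≤ δ * σc r K s)
    (hD₀ : ∀ r K s, 2 * ((m₀g r K s : ℝ) + β r (jl r K (Sum.inl s)) * ∑ _p ∈ Pwg r K s, (8 * S0) * (8 + 4 * (8 * S0))) / (1 - δ) ≤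
      D r (lvl r K (Sum.inl s)))
    (hF₀ : ∀ r K t, ∀ s ∈ S₀ r K, F r K t (Sum.inl s) = giF (lo₀ r K s) (hi₀ r K s) (σc r K s) (β r (jl r K (Sum.inl s))) (Pwg r K s))
    (hu₀ : ∀ r K t, ∀ s ∈ S₀ r K, u r K t (Sum.inl s) = wilsonU (hPug r K s))
    -- ══ END-I's own rows over the DISJOINT SUMS ((R)+[dict], finiteness, `LiveWindow` ×2, `0 < ϑ < 1`, `D ≤ D̄`, rates) ══
    {ι : Type*} {T : ℕ → Finset ι} {A B shA shB : ℕ → ℝ → ι → ℝ}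
    {pieceA pieceB : ℕ → ℝ → σ₀ ⊕ σ₁ → ι → ℝ} {MA MB : ℕ → ℝ → σ₀ ⊕ σ₁ → ℝ} {N₁ : ℕ} {νbar Dbar crate ϑ : ℝ}
    (hFfin : ∀ r K t s, ∫⁻ U, F r K t s U ∂(fieldMeasure (P r K s) (jl r K s) SU2) ≠ ∞)
    (sh_nonnegA : ∀ K t, |t| ≤ l₀ → ∀ τ ∈ T K, 0 ≤ shA K t τ)
    (sh_leA : ∀ K t, |t| ≤ l₀ → ∀ τ ∈ T K, shA K t τ ≤ A K t τ)
    (coverA : ∀ K t, |t| ≤ l₀ → ∀ τ ∈ T K, shA K t τ ≤ ∑ s ∈ (S₀ true K).disjSum (S₁ true K), pieceA K t s τ)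
    (hMA : ∀ K t, |t| ≤ l₀ → ∀ s ∈ (S₀ true K).disjSum (S₁ true K), 0 ≤ MA K t s)
    (piece_leA : ∀ K t, |t| ≤ l₀ → ∀ s ∈ (S₀ true K).disjSum (S₁ true K), ∑ τ ∈ T K, pieceA K t s τ ≤ MA K t s *
      (((fieldMeasure (P true K s) (jl true K s) SU2).withDensity (F true K t s))
        {x | ε true (K - lvl true K s) * (1 - ρ true (lvl true K s)) ≤ u true K t s x / η true (jl true K s) ^ 2 ∧
          u true K t s x / η true (jl true K s) ^ 2 < ε true (K - lvl true K s)}).toReal)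
    (total_geA : ∀ K t, |t| ≤ l₀ → ∀ s ∈ (S₀ true K).disjSum (S₁ true K),
      MA K t s * (((fieldMeasure (P true K s) (jl true K s) SU2).withDensity (F true K t s)) Set.univ).toReal ≤
        ∑ τ ∈ T K, A K t τ)
    (sh_nonnegB : ∀ K t, |t| ≤ l₀ → ∀ τ ∈ T K, 0 ≤ shB K t τ)
    (sh_leB : ∀ K t, |t| ≤ l₀ → ∀ τ ∈ T K, shB K t τ ≤ B K t τ)
    (coverB : ∀ K t, |t| ≤ l₀ → ∀ τ ∈ T K, shB K t τ ≤ ∑ s ∈ (S₀ false K).disjSum (S₁ false K), pieceB K t s τ)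
    (hMB : ∀ K t, |t| ≤ l₀ → ∀ s ∈ (S₀ false K).disjSum (S₁ false K), 0 ≤ MB K t s)
    (piece_leB : ∀ K t, |t| ≤ l₀ → ∀ s ∈ (S₀ false K).disjSum (S₁ false K), ∑ τ ∈ T K, pieceB K t s τ ≤ MB K t s *
      (((fieldMeasure (P false K s) (jl false K s) SU2).withDensity (F false K t s))
        {x | ε false (K - lvl false K s) * (1 - ρ false (lvl false K s)) ≤ u false K t s x / η false (jl false K s) ^ 2 ∧
          u false K t s x / η false (jl false K s) ^ 2 < ε false (K - lvl false K s)}).toReal)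
    (total_geB : ∀ K t, |t| ≤ l₀ → ∀ s ∈ (S₀ false K).disjSum (S₁ false K),
      MB K t s * (((fieldMeasure (P false K s) (jl false K s) SU2).withDensity (F false K t s)) Set.univ).toReal ≤
        ∑ τ ∈ T K, B K t τ)
    (hw : ∀ r, LiveWindow (fun K => (S₀ r K).disjSum (S₁ r K)) (lvl r) N₁ νbar) (hϑ0 : 0 < ϑ) (hϑ1 : ϑ < 1)
    (hDbar : ∀ r j, D r j ≤ Dbar) (hrate : ∀ r j, ρ r j ≤ crate * ϑ ^ j) :
    ShellWeightBound l₀ T A B shA shB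
      (fun K => ∑ s ∈ (S₀ true K).disjSum (S₁ true K), D true (lvl true K s) * ρ true (lvl true K s) +
        ∑ s ∈ (S₀ false K).disjSum (S₁ false K), D false (lvl false K s) * ρ false (lvl false K s)) := by
  -- the background-mediated slots: file 1 (host ∘ S90) at `s ↦ Sum.inr s`
  have hlive := hac_live_of_assembled_decay_levels_cfB7_lin_junction (fun r K s => P r K (Sum.inr s)) (fun r K s => jl r K (Sum.inr s)) (fun r K s => lvl r K (Sum.inr s)) hη hε hρ0 hn
    hN Λ hΛbox hΛcomb e hS hSπ hF hFi hu hui hPu plq N hPuN holN hRN hθN hδ0N hδ1N hSMN hANN Λu U₀u hU₀u wu wu' hw₀ hw₀' hfl hfl' 𝒢 W𝒱 h𝒢 hW hB₀ hC₄ hε₄ hdL hC₁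
    hε₁ hB₃ h1 h2 h3 H₁ hH₁ TΦ hTb hSr k Sf Sf' Sw Sw' Se Se' Ubg hUbg hα hα3 hα4 hα6 h52locw h52loce ϖe₁ ϖe₂ hϖe₁ hϖe₂ hreache ιs hι Hop hH h18 hcoup h3R hδw
    Bref hBref pos posz pos' posx posb hmultw hmultz hmultx hmultb k𝒢 kι kH kH₁ hc𝒢 hk𝒢 hgap𝒢 hM𝒢c hcι hkι hgapι hMιc hcH hkH hgapH hMHc hcH₁ hkH₁ hgapH₁ hMH₁c
    W𝒱w hB𝒢w hWw hB₀w hC₄w hε₄w hdomw hselfw hcontrw hBH₁w Tw hTbw h2Sw hιw hBHw hqw hRCw NW hlocW hreachW hreachC hsupp hqW hk Pw ℓw suppw ϖPw hblindw hdepthw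
    hϖPw hκwb hκcb hℓwb hcurlw hlenw 𝓡𝒴w h𝓡𝒴w 𝓡𝒵w 𝓡ℬw h𝒢rw hWrw hιrw hHrw hH₁rw hTrw hskew Bp hBu hBd hd hdbar hKw hδ' hϖ 𝒢e W𝒱e h𝒢e hWe hB₀e hC₄e hbe hε₄e
    hdome hselfe hcontre H₁e hH₁e Te hTbe hSre ιe hιe He hHe hqe hRCe I hrE hEd hEb supp hblind ϖP hdepth hK hcoupE μ hg Aex hint hpos hA hElb₂ L 𝓡𝒵 𝓡ℬ h𝒢r hWr
    hιr hHr hH₁r hTr hRdict hudict hδ0 hδ1 hη1 hs₁' ha' hma' hsm ha0 hrad hcover hcore hcollar hρ hβ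
  -- the Gibbs slots: leaf-06-g7's f1b at `s ↦ Sum.inl s`
  have hgibbs := hac_gibbs_of_identified (fun r K s => P r K (Sum.inl s)) (fun r K s => jl r K (Sum.inl s))
    (fun r K s => lvl r K (Sum.inl s)) hη hε hρ0 lo₀ hi₀ hN₀ hm Λg hΛbox₀ hΛcomb₀ hcov eg hS0 hS08 hS0π hσ hrad₀ hPug hPubox Pwg
    hδ0 hδ1 hρ hβ hSM hSMσ hD₀ S₀ (fun r K t s => F r K t (Sum.inl s)) (fun r K t s => u r K t (Sum.inl s)) hF₀ hu₀
  -- both kinds, at the level constant `D r (lvl r K s)`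
  have hunion : ∀ (r : Bool) (K : ℕ) (t : ℝ), |t| ≤ l₀ → ∀ s ∈ (S₀ r K).disjSum (S₁ r K),
      SlotAntiConcentration ((fieldMeasure (P r K s) (jl r K s) SU2).withDensity (F r K t s))
        (fun U => u r K t s U / η r (jl r K s) ^ 2) (ε r (K - lvl r K s)) (ρ r (lvl r K s)) (D r (lvl r K s)) := by
    intro r K t ht s hs
    rcases Finset.mem_disjSum.1 hs with ⟨a, ha, rfl⟩ | ⟨b, hb, rfl⟩
    · exact hgibbs r K t a ha
    · exact slotAntiConcentration_mono (hρ0 r _) (hDslot r K t ht b hb) (hlive r K t b)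
  -- END-I (S27 §2: slot towers, age thresholds) with `DslotX := DX ∘ lvlX` and `hacA`∕`hacB` := `hunion true`∕`hunion false`
  exact shellWeightBound_of_towerData_sync (G := SU2) (PA := P true) (jA := jl true) (PB := P false) (jB := jl false)
    (SA := fun K => (S₀ true K).disjSum (S₁ true K)) (SB := fun K => (S₀ false K).disjSum (S₁ false K))
    (θA := fun K s => ε true (K - lvl true K s)) (θB := fun K s => ε false (K - lvl false K s))
    (uA := fun K t s U => u true K t s U / η true (jl true K s) ^ 2)
    (uB := fun K t s U => u false K t s U / η false (jl false K s) ^ 2)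
    (DslotA := fun K _ s => D true (lvl true K s)) (DslotB := fun K _ s => D false (lvl false K s))
    (hFfin true) sh_nonnegA sh_leA coverA hMA piece_leA total_geA (hD0 true) (hρ0 true) (fun K t _ s _ => le_rfl)
    (hunion true)
    (hFfin false) sh_nonnegB sh_leB coverB hMB piece_leB total_geB (hD0 false) (hρ0 false) (fun K t _ s _ => le_rfl)
    (hunion false)
    (hw true) (hw false) hϑ0 hϑ1 (hDbar true) (hDbar false) (hrate true) (hrate false)

end Summit.QuantumFields.BalabanUV.T4Continuum.ShellMeasureLiveEndOneCallUnionLevelsCfLinJunction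

end
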